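import Mathlib.Algebra.Group.ForwardDiff
import Literature.NumberTheory.Automorphic.RightTranslationGL
import Literature.NumberTheory.Automorphic.JordanDecompositionGL
import Literature.NumberTheory.Automorphic.TorusCharacters
import HarnessLib

/-!
# The Jordan decomposition in an algebraic group (Springer 2.4.8)

Trunk T-AUTOMORPHIC (G25 AutomorphicL); continuation of `JordanDecompositionGL.lean` (the
multiplicative Jordan decomposition `g = g_s g_u` in `GL n k`, `IsJordanDecomp`) and
`RightTranslationGL.lean` (right translations `ρ(x)` on `k[x_{ij}, det⁻¹]`, the pieces
`k[x_{ij}, det⁻¹]_{≤ d}` and `rTransRepDeg`, an algebraic group as the stabiliser of its ideal),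
namespace `Literature.Automorphic`. Main result, proved:

* `IsJordanDecomp.mem_of_mem`, `exists_isJordanDecomp_mem` — **Springer 2.4.8 (i)** (with
  (iii)): if `G ≤ GL n k` is an algebraic subgroup over an algebraically closed field and `g ∈ G`,
  then the semisimple and unipotent parts `g_s, g_u` of `g` lie in `G`;
* `IsSemisimpleElt.map_of_isAlgebraicGL`, `IsUnipotentElt.map_of_isAlgebraicGL`,
  `IsJordanDecomp.map_of_isAlgebraicGL` — **Springer 2.4.8 (ii)**: an algebraic homomorphism
  `φ : G → GL m k` maps semisimple elements to semisimple elements, unipotent to unipotent, and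
  Jordan decompositions to Jordan decompositions. Here `kᵐ` with `φ(g)` is embedded
  `G`-equivariantly into a power of a quotient of `k[x_{ij}, det⁻¹]_{≤ d}` with `ρ(g)`
  (`exists_intertwiner_rTransRepDeg`, the map `v ↦ (g ↦ ℓᵢ(φ(g) v))` of the proof of
  2.4.8 (iii)), and semisimplicity / unipotence pass to quotients (`isSemisimple_mapQ`), powers
  (Mathlib `LinearMap.compLeft`), invariant subspaces and conjugates.

The proof is Springer's (2.4.8 via 2.3.6): on each `ρ`-stable finite-dimensional piece
`k[x_{ij}, det⁻¹]_{≤ d}`, `ρ(g_s)` is semisimple and `ρ(g_u)` is unipotent, so by the uniqueness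
of the Jordan–Chevalley decomposition (Mathlib `Module.End.isNilpotent_isSemisimple_unique`)
`ρ(g_s) ∈ k[ρ(g)]` preserves the `ρ(g)`-stable subspace `𝓘(G)_{≤ d}`; hence `ρ(g_s)` preserves
`𝓘(G)` and `g_s ∈ G` (`mem_of_rTransGL_vanishingIdeal`). The two functoriality statements are
proved as follows.

* `isSemisimple_rTransRepDeg` (semisimple half): a semisimple `s` is diagonalisable
  (`IsSemisimpleElt.exists_conj_diagonal`, via `exists_conj_le_diagonalSubgroup` of
  `TorusCharacters.lean` applied to the cyclic group of `s`; `IsSemisimpleElt.inv`, `.zpow`), and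
  `ρ(diag)` is diagonal on monomials (`isSemisimple_rTransRepDeg_diagonalGL`).
* `isNilpotent_rTransRepDeg_sub_one` (unipotent half), by a **finite-difference argument** valid
  in every characteristic: `FDDegLE d f` ("`Δ^{d+1} f = 0`", a calculus of polynomial-like
  functions `ℕ → A` built on Mathlib's `fwdDiff`: sums, products `FDDegLE.mul`, additive maps);
  the powers `m ↦ u^m` of a unipotent matrix have finite degree (`IsUnipotentElt.fdDegLE_pow`,
  with `det u = 1`, `IsUnipotentElt.det_eq_one`), hence so has `m ↦ ρ(u)^m p = ρ(u^m) p`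
  (`IsUnipotentElt.fdDegLE_rTransGL`), and a multiplicative sequence `m ↦ R^m v` of finite
  degree `D` satisfies `(R - 1)^{D+1} v = 0` (`pow_sub_one_apply_eq_zero_of_fdDegLE`, since
  `Δ^j (m ↦ R^m) = (m ↦ R^m (R-1)^j)`).

## Library

`UnipotentOneParameter.lean` (not imported; another finite-difference argument, for images of
`𝔾ₐ`) provides `IsSemisimpleElt.eq_one_of_isUnipotentElt` (`G_s ∩ G_u = {e}`).

## References

* [SpringerLAG1998] T. A. Springer, *Linear Algebraic Groups*, 2nd ed., Progress in
  Mathematics 9, Birkhäuser (1998): 2.3.6, 2.4.2 (ii), 2.4.4–2.4.5, 2.4.8.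
-/

open fwdDiff

namespace Literature.NumberTheory.Automorphic

/-! ### Functions on `ℕ` of finite-difference degree `≤ d` -/

section FDDegree

variable {A : Type*}

/-- `f : ℕ → A` has *finite-difference degree `≤ d`* if `Δ^{d+1} f = 0` (`Δ f (m) = f (m+1) - f m`);
e.g. `m ↦ m.choose j` for `j ≤ d`, or any polynomial function of degree `≤ d`. [folklore] -/
def FDDegLE [AddCommGroup A] (d : ℕ) (f : ℕ → A) : Prop :=
  (Δ_[1])^[d + 1] f = 0

variable [AddCommGroup A]

/-- Unfolding `FDDegLE`: `Δ^{d+1} f = 0`. [folklore] -/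
lemma FDDegLE.iterate_eq_zero {d : ℕ} {f : ℕ → A} (h : FDDegLE d f) : (Δ_[1])^[d + 1] f = 0 := h

/-- Constants have degree `≤ 0`. [folklore] -/
lemma fdDegLE_const (a : A) : FDDegLE 0 (fun _ : ℕ => a) := by
  simp only [FDDegLE, zero_add, Function.iterate_one, fwdDiff_const]
  rfl

/-- The zero function has every degree. [folklore] -/
lemma fdDegLE_zero (d : ℕ) : FDDegLE d (0 : ℕ → A) := by
  induction d with
  | zero =>
    rw [FDDegLE, zero_add, Function.iterate_one]
    exact funext fun _ => sub_self _
  | succ d ih =>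
    rw [FDDegLE, Function.iterate_succ_apply]
    have : Δ_[1] (0 : ℕ → A) = 0 := funext fun _ => sub_self _
    rw [this]
    exact ih

/-- `Δ f` has degree `≤ d` iff `f` has degree `≤ d + 1`. [folklore] -/
lemma fdDegLE_succ_iff {d : ℕ} {f : ℕ → A} : FDDegLE (d + 1) f ↔ FDDegLE d (Δ_[1] f) := by
  rw [FDDegLE, FDDegLE, Function.iterate_succ_apply]

/-- Monotonicity in the degree. [folklore] -/
lemma FDDegLE.mono {d d' : ℕ} {f : ℕ → A} (h : FDDegLE d f) (hdd' : d ≤ d') : FDDegLE d' f := by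
  obtain ⟨e, rfl⟩ := Nat.exists_eq_add_of_le hdd'
  rw [FDDegLE, show d + e + 1 = e + (d + 1) by omega, Function.iterate_add_apply, h.iterate_eq_zero]
  clear h hdd'
  induction e with
  | zero => rfl
  | succ e ih =>
    rw [Function.iterate_succ_apply, show Δ_[1] (0 : ℕ → A) = 0 from funext fun _ => sub_self _]
    exact ih

/-- Sums. [folklore] -/
lemma FDDegLE.add {d : ℕ} {f g : ℕ → A} (hf : FDDegLE d f) (hg : FDDegLE d g) : FDDegLE d (f + g) := by
  rw [FDDegLE, fwdDiff_iter_add, hf.iterate_eq_zero, hg.iterate_eq_zero, add_zero]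

/-- Finite sums. [folklore] -/
lemma fdDegLE_finsetSum {ι : Type*} (s : Finset ι) {d : ℕ} {f : ι → ℕ → A}
    (h : ∀ i ∈ s, FDDegLE d (f i)) : FDDegLE d (∑ i ∈ s, f i) := by
  rw [FDDegLE, fwdDiff_iter_finsetSum]
  exact Finset.sum_eq_zero fun i hi => (h i hi).iterate_eq_zero

/-- Shifts. [folklore] -/
lemma FDDegLE.comp_add {d : ℕ} {f : ℕ → A} (hf : FDDegLE d f) (m : ℕ) :
    FDDegLE d (fun r => f (r + m)) := by
  rw [FDDegLE]
  funext y
  rw [fwdDiff_iter_comp_add, hf.iterate_eq_zero]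
  rfl

end FDDegree

section FDDegreeRing

variable {A : Type*} [Ring A]

/-- Products: degrees add (Leibniz rule `Δ(fg) = Δf·g + f·Δg + Δf·Δg`). [folklore] -/
theorem FDDegLE.mul : ∀ {a b : ℕ} {f g : ℕ → A}, FDDegLE a f → FDDegLE b g → FDDegLE (a + b) (f * g) := by
  -- double induction on `a`, then `b`
  intro a
  induction a with
  | zero =>
    intro b
    induction b with
    | zero =>
      intro f g hf hg
      rw [FDDegLE, zero_add, Function.iterate_one] at hf hg ⊢
      rw [show f * g = f • g from rfl, fwdDiff_smul, hf, hg]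
      simp
    | succ b ihb =>
      intro f g hf hg
      rw [zero_add, fdDegLE_succ_iff]
      rw [fdDegLE_succ_iff] at hg
      have hf' : Δ_[1] f = 0 := by simpa [FDDegLE] using hf
      rw [show f * g = f • g from rfl, fwdDiff_smul, hf']
      simpa using ihb hf hg
  | succ a iha =>
    intro b
    induction b with
    | zero =>
      intro f g hf hg
      rw [add_zero, fdDegLE_succ_iff]
      rw [fdDegLE_succ_iff] at hf
      have hg' : Δ_[1] g = 0 := by simpa [FDDegLE] using hg
      rw [show f * g = f • g from rfl, fwdDiff_smul, hg']
      simpa using iha hf hg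
    | succ b ihb =>
      intro f g hf hg
      have hf' := fdDegLE_succ_iff.1 hf
      have hg' := fdDegLE_succ_iff.1 hg
      rw [show a + 1 + (b + 1) = (a + b + 1) + 1 by omega, fdDegLE_succ_iff,
        show f * g = f • g from rfl, fwdDiff_smul]
      refine FDDegLE.add (FDDegLE.add ?_ ?_) ?_
      · -- `Δf · g`
        simpa [show a + (b + 1) = a + b + 1 by omega] using iha hf' hg
      · -- `f · Δg`
        simpa [show a + 1 + b = a + b + 1 by omega] using ihb hf hg'
      · -- `Δf · Δg`
        exact (by simpa using iha hf' hg' : FDDegLE (a + b) (Δ_[1] f * Δ_[1] g)).mono (by omega)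

/-- Finite products: degrees add. [folklore] -/
theorem fdDegLE_finsetProd {A : Type*} [CommRing A] {ι : Type*} (s : Finset ι) {d : ι → ℕ}
    {f : ι → ℕ → A} (h : ∀ i ∈ s, FDDegLE (d i) (f i)) :
    FDDegLE (∑ i ∈ s, d i) (∏ i ∈ s, f i) := by
  classical
  induction s using Finset.induction_on with
  | empty =>
    simp only [Finset.sum_empty, Finset.prod_empty]
    exact fdDegLE_const (1 : A)
  | insert i s hi ih =>
    rw [Finset.prod_insert hi, Finset.sum_insert hi]
    exact (h i (Finset.mem_insert_self i s)).mul (ih fun j hj => h j (Finset.mem_insert_of_mem hj))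

/-- Powers. [folklore] -/
theorem FDDegLE.pow {A : Type*} [CommRing A] {d : ℕ} {f : ℕ → A} (hf : FDDegLE d f) (e : ℕ) :
    FDDegLE (e * d) (f ^ e) := by
  have h := fdDegLE_finsetProd (Finset.range e) (d := fun _ => d) (f := fun _ => f) fun _ _ => hf
  simpa [Finset.prod_const, Finset.card_range] using h

/-- A left constant factor. [folklore] -/
lemma FDDegLE.const_mul {d : ℕ} {f : ℕ → A} (hf : FDDegLE d f) (c : A) :
    FDDegLE d (fun m => c * f m) := by
  have h := (fdDegLE_const c).mul hf
  rw [zero_add] at h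
  exact h

/-- Composition with an additive map preserves the degree. [folklore] -/
lemma FDDegLE.map {B : Type*} [AddCommGroup B] {d : ℕ} {f : ℕ → A} (hf : FDDegLE d f)
    (φ : A →+ B) : FDDegLE d (φ ∘ f) := by
  rw [FDDegLE] at hf ⊢
  have key : ∀ (j : ℕ) (f : ℕ → A), (Δ_[1])^[j] (φ ∘ f) = φ ∘ (Δ_[1])^[j] f := by
    intro j
    induction j with
    | zero => intro f; rfl
    | succ j ih =>
      intro f
      rw [Function.iterate_succ_apply, Function.iterate_succ_apply, ← ih]
      congr 1
      funext m
      simp [fwdDiff]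
  rw [key, hf]
  funext m
  simp

/-- `Δ^j (m ↦ R^m) = (m ↦ R^m (R - 1)^j)` in any ring. [folklore] -/
theorem iterate_fwdDiff_pow (R : A) (j : ℕ) :
    (Δ_[1])^[j] (fun m : ℕ => R ^ m) = fun m => R ^ m * (R - 1) ^ j := by
  induction j with
  | zero => funext m; simp
  | succ j ih =>
    rw [Function.iterate_succ_apply', ih]
    funext m
    simp only [fwdDiff]
    rw [pow_succ R m, mul_assoc, ← mul_sub, ← sub_one_mul, ← pow_succ']

/-- **Multiplicative sequences of finite degree are unipotent**: if `R` is an element of a ring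
with `m ↦ R ^ m` of finite-difference degree `≤ D`, then `(R - 1) ^ (D + 1) = 0`
(`Δ^j (m ↦ R^m) = (m ↦ R^m (R - 1)^j)`). [folklore] -/
theorem pow_sub_one_eq_zero_of_fdDegLE {R : A} {D : ℕ} (h : FDDegLE D fun m : ℕ => R ^ m) :
    (R - 1) ^ (D + 1) = 0 := by
  have h0 := congrFun (iterate_fwdDiff_pow R (D + 1)) 0
  rw [h.iterate_eq_zero] at h0
  simpa using h0.symm

end FDDegreeRing


open Polynomial
open scoped MatrixGroups Matrix

variable {k : Type*} [Field k] {n : Type*} [Fintype n] [DecidableEq n]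

/-! ### Unipotent matrices: powers of finite difference degree, determinant one -/

section UnipotentPowers

/-- The same for the action on a module: `Δ^j (m ↦ R^m v) = (m ↦ R^m (R - 1)^j v)`. [folklore] -/
theorem iterate_fwdDiff_pow_apply {V : Type*} [AddCommGroup V] [Module k V] (R : Module.End k V)
    (v : V) (j : ℕ) :
    (Δ_[1])^[j] (fun m : ℕ => (R ^ m) v) = fun m => (R ^ m * (R - 1) ^ j) v := by
  have h := iterate_fwdDiff_pow R j
  have key : ∀ (i : ℕ) (F : ℕ → Module.End k V),
      (Δ_[1])^[i] (fun m => F m v) = fun m => ((Δ_[1])^[i] F m) v := by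
    intro i
    induction i with
    | zero => intro F; rfl
    | succ i ih =>
      intro F
      rw [Function.iterate_succ_apply, Function.iterate_succ_apply, ← ih]
      congr 1
  rw [key, h]

/-- If `m ↦ R^m v` has finite-difference degree `≤ D` then `(R - 1)^(D+1) v = 0`. [folklore] -/
theorem pow_sub_one_apply_eq_zero_of_fdDegLE {V : Type*} [AddCommGroup V] [Module k V]
    {R : Module.End k V} {v : V} {D : ℕ} (h : FDDegLE D fun m : ℕ => (R ^ m) v) :
    ((R - 1) ^ (D + 1)) v = 0 := by
  have h0 := congrFun (iterate_fwdDiff_pow_apply R v (D + 1)) 0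
  rw [h.iterate_eq_zero] at h0
  simpa using h0.symm

/-- A nilpotent `n × n` matrix over a field satisfies `M ^ card n = 0` (Cayley–Hamilton: its
characteristic polynomial is `X ^ card n`). [folklore] -/
theorem pow_card_eq_zero_of_isNilpotent {M : Matrix n n k} (hM : IsNilpotent M) :
    M ^ Fintype.card n = 0 := by
  have hcp : M.charpoly = X ^ Fintype.card n := by
    rw [← sub_eq_zero]
    exact (Matrix.isNilpotent_charpoly_sub_pow_of_isNilpotent hM).eq_zero
  have h := Matrix.aeval_self_charpoly M
  rwa [hcp, map_pow, aeval_X] at h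

/-- `g ∈ GL n k` is unipotent iff `(g - 1) ^ card n = 0`. [folklore] -/
theorem isUnipotentElt_iff_pow_card {g : GL n k} :
    IsUnipotentElt g ↔ ((g : Matrix n n k) - 1) ^ Fintype.card n = 0 :=
  ⟨pow_card_eq_zero_of_isNilpotent, fun h => ⟨_, h⟩⟩

/-- **The powers of a unipotent matrix have finite-difference degree `≤ card n`**: for
`u = 1 + N`, `Δ^j (m ↦ u^m) = u^m N^j` vanishes for `j > card n`. [folklore] -/
theorem IsUnipotentElt.fdDegLE_pow {u : GL n k} (hu : IsUnipotentElt u) :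
    FDDegLE (Fintype.card n) fun m : ℕ => ((u ^ m : GL n k) : Matrix n n k) := by
  rw [FDDegLE]
  simp only [Units.val_pow_eq_pow_val]
  rw [iterate_fwdDiff_pow]
  funext m
  rw [pow_succ, ← mul_assoc, pow_card_eq_zero_of_isNilpotent hu, Matrix.mul_zero, Matrix.zero_mul]
  rfl

/-- **A unipotent matrix has determinant one** (`det (1 + N) = 1` for nilpotent `N`: evaluate
the characteristic polynomial `X ^ n` of `N` at `-1`). [folklore] -/
theorem IsUnipotentElt.det_eq_one {u : GL n k} (hu : IsUnipotentElt u) :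
    Matrix.det ((u : GL n k) : Matrix n n k) = 1 := by
  set N : Matrix n n k := (u : Matrix n n k) - 1 with hN
  have hcp : N.charpoly = X ^ Fintype.card n := by
    rw [← sub_eq_zero]
    exact (Matrix.isNilpotent_charpoly_sub_pow_of_isNilpotent hu).eq_zero
  have h := Matrix.eval_charpoly N (-1)
  rw [hcp, eval_pow, eval_X] at h
  -- `scalar (-1) - N = -(u)`
  have e : Matrix.scalar n (-1 : k) - N = -((u : GL n k) : Matrix n n k) := by
    rw [hN, map_neg, map_one]
    abel
  rw [e, Matrix.det_neg] at h
  -- `(-1)^n = (-1)^n det u`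
  have hunit : IsUnit ((-1 : k) ^ Fintype.card n) := (isUnit_one.neg).pow _
  exact hunit.mul_right_injective (h.symm.trans (mul_one _).symm)

end UnipotentPowers

/-! ### `ρ(u)` is unipotent on each `k[x_{ij}, det⁻¹]_{≤ d}` for unipotent `u` -/

section UnipotentTranslation

/-- For unipotent `u`, the substitution polynomials `m ↦ rTransPolyGL (u^m) c` have
finite-difference degree `≤ card n` (their coefficients are entries of `u^m`, and `det u^m = 1`).
[folklore] -/
theorem IsUnipotentElt.fdDegLE_rTransPolyGL {u : GL n k} (hu : IsUnipotentElt u) (c : GLCoord n) :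
    FDDegLE (Fintype.card n) fun m : ℕ => rTransPolyGL (u ^ m) c := by
  rcases c with ⟨i, j⟩ | v
  · -- `∑ₗ X_{il} · C ((u^m)_{lj})`
    have h : (fun m : ℕ => rTransPolyGL (u ^ m) (Sum.inl (i, j))) =
        ∑ l : n, fun m : ℕ => MvPolynomial.X (Sum.inl (i, l)) *
          MvPolynomial.C (((u ^ m : GL n k) : Matrix n n k) l j) := by
      funext m
      simp [rTransPolyGL, Finset.sum_apply]
    rw [h]
    refine fdDegLE_finsetSum _ fun l _ => ?_
    -- entry `(l, j)` then `a ↦ X * C a`, both additive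
    let φ : Matrix n n k →+ MvPolynomial (GLCoord n) k :=
      { toFun := fun M => MvPolynomial.X (Sum.inl (i, l)) * MvPolynomial.C (M l j)
        map_zero' := by simp
        map_add' := fun M M' => by simp [mul_add] }
    exact hu.fdDegLE_pow.map φ
  · -- `X_y · C (det u^m)⁻¹ = X_y`, constant
    have h : (fun m : ℕ => rTransPolyGL (u ^ m) (Sum.inr v)) =
        fun _ => MvPolynomial.X (Sum.inr ()) := by
      funext m
      have hdet : Matrix.det ((u : GL n k) : Matrix n n k) ^ m = 1 := by
        rw [hu.det_eq_one, one_pow]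
      simp [rTransPolyGL, Units.val_pow_eq_pow_val, Matrix.det_pow, hdet]
    rw [h]
    exact (fdDegLE_const _).mono (Nat.zero_le _)

/-- Hence `m ↦ ρ(u^m) p` has finite-difference degree `≤ d · card n` for `p` of total degree
`≤ d`. [folklore] -/
theorem IsUnipotentElt.fdDegLE_rTransGL {u : GL n k} (hu : IsUnipotentElt u)
    {p : MvPolynomial (GLCoord n) k} {d : ℕ} (hp : p.totalDegree ≤ d) :
    FDDegLE (d * Fintype.card n) fun m : ℕ => rTransGL (u ^ m) p := by
  classical
  have e : (fun m : ℕ => rTransGL (u ^ m) p) = ∑ mo ∈ p.support, fun m : ℕ =>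
      MvPolynomial.C (p.coeff mo) * ∏ c ∈ mo.support, rTransPolyGL (u ^ m) c ^ mo c := by
    funext m
    rw [rTransGL, ← MvPolynomial.aeval_eq_bind₁, MvPolynomial.aeval_def, MvPolynomial.eval₂_eq]
    simp [Finset.sum_apply]
  rw [e]
  refine fdDegLE_finsetSum _ fun mo hmo => ?_
  have hprod : FDDegLE (∑ c ∈ mo.support, mo c * Fintype.card n)
      (fun m : ℕ => ∏ c ∈ mo.support, rTransPolyGL (u ^ m) c ^ mo c) := by
    have h := fdDegLE_finsetProd mo.support (d := fun c => mo c * Fintype.card n)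
      (f := fun c m => rTransPolyGL (u ^ m) c ^ mo c) fun c _ => (hu.fdDegLE_rTransPolyGL c).pow (mo c)
    have hfun : (fun m : ℕ => ∏ c ∈ mo.support, rTransPolyGL (u ^ m) c ^ mo c) =
        ∏ c ∈ mo.support, fun m : ℕ => rTransPolyGL (u ^ m) c ^ mo c := by
      funext m
      simp [Finset.prod_apply]
    rw [hfun]
    exact h
  refine ((hprod.const_mul (MvPolynomial.C (p.coeff mo))).mono ?_)
  rw [← Finset.sum_mul]
  exact Nat.mul_le_mul_right _ ((MvPolynomial.le_totalDegree hmo).trans hp)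

/-- **`ρ(u)` is unipotent on `k[x_{ij}, det⁻¹]_{≤ d}` for unipotent `u`** (Springer 2.4.7–2.4.8,
unipotent half; proved by finite differences: `m ↦ ρ(u)^m p = ρ(u^m) p` is a polynomial
function of `m` of degree `≤ d n`, and a multiplicative sequence of finite degree is unipotent,
`pow_sub_one_apply_eq_zero_of_fdDegLE`). [cite: SpringerLAG1998, 2.4.8 (proof)] -/
theorem isNilpotent_rTransRepDeg_sub_one {u : GL n k} (hu : IsUnipotentElt u) (d : ℕ) :
    IsNilpotent (rTransRepDeg (k := k) d u - 1) := by
  refine ⟨d * Fintype.card n + 1, ?_⟩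
  apply LinearMap.ext
  intro p
  rw [LinearMap.zero_apply]
  have hfd : FDDegLE (d * Fintype.card n) fun m : ℕ => (rTransRepDeg (k := k) d u ^ m) p := by
    have h := hu.fdDegLE_rTransGL ((MvPolynomial.mem_restrictTotalDegree _ _ _).1 p.2) (d := d)
    -- compare through the (injective, additive) coercion to polynomials
    rw [FDDegLE] at h ⊢
    have key : ∀ (j : ℕ) (F : ℕ → MvPolynomial.restrictTotalDegree (GLCoord n) k d),
        (Δ_[1])^[j] (fun m => ((F m : MvPolynomial.restrictTotalDegree (GLCoord n) k d) :
          MvPolynomial (GLCoord n) k)) = fun m => (((Δ_[1])^[j] F m :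
            MvPolynomial.restrictTotalDegree (GLCoord n) k d) : MvPolynomial (GLCoord n) k) := by
      intro j
      induction j with
      | zero => intro F; rfl
      | succ j ih =>
        intro F
        rw [Function.iterate_succ_apply, Function.iterate_succ_apply, ← ih]
        congr 1
    have hF : (fun m : ℕ => rTransGL (u ^ m) (p : MvPolynomial (GLCoord n) k)) =
        fun m => ((rTransRepDeg (k := k) d u ^ m) p : MvPolynomial (GLCoord n) k) := by
      funext m
      rw [← map_pow, coe_rTransRepDeg_apply]
    rw [hF, key] at h
    funext m
    exact Subtype.ext (congrFun h m)
  exact pow_sub_one_apply_eq_zero_of_fdDegLE hfd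

end UnipotentTranslation

/-! ### `ρ(s)` is semisimple on each `k[x_{ij}, det⁻¹]_{≤ d}` for semisimple `s` -/

section SemisimpleTranslation

/-- For an automorphism of a finite-dimensional space, a subspace is invariant iff it is
invariant under the inverse. [folklore] -/
lemma mem_invtSubmodule_linearEquiv_iff_symm {V : Type*} [AddCommGroup V] [Module k V]
    [FiniteDimensional k V] (e : V ≃ₗ[k] V) (p : Submodule k V) :
    p ∈ Module.End.invtSubmodule (e : Module.End k V) ↔
      p ∈ Module.End.invtSubmodule (e.symm : Module.End k V) := by
  have key : ∀ (e : V ≃ₗ[k] V), p ∈ Module.End.invtSubmodule (e : Module.End k V) →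
      p ∈ Module.End.invtSubmodule (e.symm : Module.End k V) := by
    intro e hp
    rw [Module.End.mem_invtSubmodule_iff_map_le] at hp
    have heq : p.map (e : Module.End k V) = p :=
      Submodule.eq_of_le_of_finrank_eq hp (LinearEquiv.finrank_map_eq e p)
    rw [Module.End.mem_invtSubmodule_symm_iff_le_map]
    exact heq.symm.le
  exact ⟨key e, fun h => by simpa using key e.symm h⟩

/-- The inverse of a semisimple element of `GL n k` is semisimple (the invariant subspaces of
`s` and `s⁻¹` coincide). [folklore] -/
theorem IsSemisimpleElt.inv {s : GL n k} (hs : IsSemisimpleElt s) : IsSemisimpleElt s⁻¹ := by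
  unfold IsSemisimpleElt at hs ⊢
  have hinv : ∀ p : Submodule k (n → k),
      p ∈ Module.End.invtSubmodule (Matrix.toLin' ((s⁻¹ : GL n k) : Matrix n n k)) ↔
        p ∈ Module.End.invtSubmodule (Matrix.toLin' ((s : GL n k) : Matrix n n k)) := by
    intro p
    -- `toLin' s` as a linear automorphism (Mathlib `Matrix.GeneralLinearGroup.toLin`)
    have e1 : ((Matrix.GeneralLinearGroup.toLin s).toLinearEquiv : Module.End k (n → k)) =
        Matrix.toLin' ((s : GL n k) : Matrix n n k) := rfl
    have e2 : ((Matrix.GeneralLinearGroup.toLin s).toLinearEquiv.symm : Module.End k (n → k)) =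
        Matrix.toLin' ((s⁻¹ : GL n k) : Matrix n n k) := by
      have : (Matrix.GeneralLinearGroup.toLin s).toLinearEquiv.symm =
          (Matrix.GeneralLinearGroup.toLin s⁻¹).toLinearEquiv := by
        rw [map_inv]; rfl
      rw [this]; rfl
    rw [← e1, ← e2]
    exact (mem_invtSubmodule_linearEquiv_iff_symm _ p).symm
  rw [Module.End.isSemisimple_iff] at hs ⊢
  intro p hp
  obtain ⟨q, hq, hpq⟩ := hs p ((hinv p).1 hp)
  exact ⟨q, (hinv q).2 hq, hpq⟩

/-- Powers of a semisimple element are semisimple. [folklore] -/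
theorem IsSemisimpleElt.pow {s : GL n k} (hs : IsSemisimpleElt s) (j : ℕ) :
    IsSemisimpleElt (s ^ j) := by
  unfold IsSemisimpleElt at hs ⊢
  have e : Matrix.toLin' ((s ^ j : GL n k) : Matrix n n k) =
      Matrix.toLin' ((s : GL n k) : Matrix n n k) ^ j := by
    induction j with
    | zero => rw [pow_zero, pow_zero, Units.val_one, Matrix.toLin'_one]; rfl
    | succ j ih => rw [pow_succ, pow_succ, toLin'_coe_mul, ih]
  rw [e]
  exact hs.pow j

/-- Integer powers of a semisimple element are semisimple. [folklore] -/
theorem IsSemisimpleElt.zpow {s : GL n k} (hs : IsSemisimpleElt s) (j : ℤ) :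
    IsSemisimpleElt (s ^ j) := by
  rcases Int.eq_nat_or_neg j with ⟨m, rfl | rfl⟩
  · rw [zpow_natCast]
    exact hs.pow m
  · rw [zpow_neg, zpow_natCast]
    exact (hs.pow m).inv

/-- **A semisimple element of `GL n k` is diagonalisable** (Springer 2.4.2 (ii)): over an
algebraically closed field some conjugate of `s` is diagonal. (Via `exists_conj_le_diagonalSubgroup`
of `TorusCharacters.lean` applied to the cyclic group generated by `s`.)
[cite: SpringerLAG1998, 2.4.2 (ii)] -/
theorem IsSemisimpleElt.exists_conj_diagonal [IsAlgClosed k] {s : GL n k} (hs : IsSemisimpleElt s) :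
    ∃ (P : GL n k) (dg : n → kˣ), P * s * P⁻¹ = diagonalGL n k dg := by
  have hT : IsMulCommutative ↥(Subgroup.zpowers s) := inferInstance
  have hss : ∀ t ∈ Subgroup.zpowers s, IsSemisimpleElt t := by
    intro t ht
    obtain ⟨j, rfl⟩ := Subgroup.mem_zpowers_iff.1 ht
    exact hs.zpow j
  obtain ⟨P, hP⟩ := exists_conj_le_diagonalSubgroup hT hss
  have hmem : P * s * P⁻¹ ∈ (Subgroup.zpowers s).map (MulAut.conj P).toMonoidHom :=
    ⟨s, Subgroup.mem_zpowers s, rfl⟩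
  obtain ⟨dg, hdg⟩ := hP hmem
  exact ⟨P, dg, hdg.symm⟩

/-- **`ρ(s)` is semisimple on `k[x_{ij}, det⁻¹]_{≤ d}` for semisimple `s`** (Springer 2.4.8,
semisimple half): conjugate `s` to a diagonal matrix (`IsSemisimpleElt.exists_conj_diagonal`) and
use `isSemisimple_rTransRepDeg_diagonalGL`. [cite: SpringerLAG1998, 2.4.8 (proof)] -/
theorem isSemisimple_rTransRepDeg [IsAlgClosed k] {s : GL n k} (hs : IsSemisimpleElt s) (d : ℕ) :
    (rTransRepDeg (k := k) d s).IsSemisimple := by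
  obtain ⟨P, dg, hP⟩ := hs.exists_conj_diagonal
  have hdiag := isSemisimple_rTransRepDeg_diagonalGL (k := k) d dg
  -- `ρ(P⁻¹)` conjugates `ρ(diag)` to `ρ(s)`: `s = P⁻¹ diag P`
  have hs' : s = P⁻¹ * diagonalGL n k dg * P := by
    rw [← hP]; group
  set R := rTransRepDeg (k := k) (n := n) d with hR
  let e : MvPolynomial.restrictTotalDegree (GLCoord n) k d ≃ₗ[k]
      MvPolynomial.restrictTotalDegree (GLCoord n) k d :=
    LinearEquiv.ofLinear (R P⁻¹) (R P)
      (by rw [← Module.End.mul_eq_comp, ← map_mul, inv_mul_cancel, map_one]; rfl)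
      (by rw [← Module.End.mul_eq_comp, ← map_mul, mul_inv_cancel, map_one]; rfl)
  refine (LinearEquiv.isSemisimple_iff (R (diagonalGL n k dg)) (R s) e ?_).1 hdiag
  change R P⁻¹ ∘ₗ R (diagonalGL n k dg) = R s ∘ₗ R P⁻¹
  rw [← Module.End.mul_eq_comp, ← Module.End.mul_eq_comp, ← map_mul, ← map_mul, hs']
  congr 1
  group

end SemisimpleTranslation

/-! ### The Jordan decomposition in an algebraic group (Springer 2.4.8) -/

section JordanInGroup

/-- Elements of `k[f]` leave every `f`-invariant subspace invariant. [folklore] -/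
lemma mem_invtSubmodule_of_mem_adjoin {V : Type*} [AddCommGroup V] [Module k V]
    {f a : Module.End k V} (ha : a ∈ Algebra.adjoin k {f}) {p : Submodule k V}
    (hp : p ∈ Module.End.invtSubmodule f) : p ∈ Module.End.invtSubmodule a := by
  induction ha using Algebra.adjoin_induction with
  | mem x hx =>
    rw [Set.mem_singleton_iff.1 hx]
    exact hp
  | algebraMap c =>
    rw [Module.End.mem_invtSubmodule]
    intro v hv
    simpa [Module.algebraMap_end_apply] using p.smul_mem c hv
  | add x y _ _ hx hy =>
    rw [Module.End.mem_invtSubmodule] at hx hy ⊢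
    intro v hv
    simpa using p.add_mem (hx hv) (hy hv)
  | mul x y _ _ hx hy =>
    rw [Module.End.mem_invtSubmodule] at hx hy ⊢
    intro v hv
    simpa using hx (hy hv)

variable [IsAlgClosed k]

/-- **Springer 2.4.8: the Jordan decomposition takes place inside every algebraic group.** If
`G ≤ GL n k` is an algebraic subgroup over an algebraically closed field, `g ∈ G` and `g = s u` is
its Jordan decomposition in `GL n k` (`IsJordanDecomp`, Springer 2.4.5), then `s ∈ G` and `u ∈ G`
(2.4.8 (i) with (ii)–(iii): the parts `g_s, g_u ∈ G` of (i) are, for a closed subgroup of `GL_n`,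
the parts of 2.4.5; Humphreys, *Linear Algebraic Groups*, 15.3). Proof (Springer 2.4.8 via
2.3.6): `G` is the stabiliser of its ideal `𝓘(G)` under right translations
(`mem_of_rTransGL_vanishingIdeal`); on each finite-dimensional piece `k[x_{ij}, det⁻¹]_{≤ d}` the
operators `ρ(s)`, `ρ(u)` are the Jordan parts of `ρ(g)` (`isSemisimple_rTransRepDeg`,
`isNilpotent_rTransRepDeg_sub_one`, uniqueness `Module.End.isNilpotent_isSemisimple_unique`), so
`ρ(s) ∈ k[ρ(g)]` stabilises `𝓘(G)_{≤ d}`; hence `ρ(s) 𝓘(G) ⊆ 𝓘(G)` and `s ∈ G`.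
[cite: SpringerLAG1998, 2.4.8] -/
theorem IsJordanDecomp.mem_of_mem {G : Subgroup (GL n k)} (hG : IsAlgebraicSubgroup G)
    {g s u : GL n k} (hgsu : IsJordanDecomp g s u) (hg : g ∈ G) : s ∈ G ∧ u ∈ G := by
  suffices hs : s ∈ G by
    refine ⟨hs, ?_⟩
    have hu : u = s⁻¹ * g := by rw [← hgsu.mul_eq, inv_mul_cancel_left]
    rw [hu]
    exact G.mul_mem (G.inv_mem hs) hg
  apply mem_of_rTransGL_vanishingIdeal hG
  intro p hp
  set d : ℕ := p.totalDegree with hd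
  set I := MvPolynomial.vanishingIdeal k (glCoordFun '' (G : Set (GL n k))) with hI
  -- the subspace `𝓘(G)_{≤ d}` of `k[x_{ij}, det⁻¹]_{≤ d}`
  let Id : Submodule k (MvPolynomial.restrictTotalDegree (GLCoord n) k d) :=
    (I.restrictScalars k).comap (MvPolynomial.restrictTotalDegree (GLCoord n) k d).subtype
  have hId : ∀ q : MvPolynomial.restrictTotalDegree (GLCoord n) k d,
      q ∈ Id ↔ (q : MvPolynomial (GLCoord n) k) ∈ I := fun q => Iff.rfl
  set R := rTransRepDeg (k := k) (n := n) d with hR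
  -- `𝓘(G)_{≤ d}` is `ρ(g)`-invariant
  have hinv : Id ∈ Module.End.invtSubmodule (R g) := by
    rw [Module.End.mem_invtSubmodule]
    intro q hq
    change R g q ∈ Id
    rw [hId, hR, coe_rTransRepDeg_apply]
    exact rTransGL_mem_vanishingIdeal hg ((hId q).1 hq)
  -- `ρ(s)` is the semisimple part of `ρ(g)`, so lies in `k[ρ(g)]`
  have hRs : R s ∈ Algebra.adjoin k {R g} := by
    have hmul : R g = R s * R u := by rw [← map_mul, hgsu.mul_eq]
    have hcomm : Commute (R s) (R u) := by
      change R s * R u = R u * R s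
      rw [← map_mul, ← map_mul, hgsu.commute.eq]
    have hSss : (R s).IsSemisimple := isSemisimple_rTransRepDeg hgsu.semisimple d
    have h1 : Commute (R s) (R u - 1) := by
      change R s * (R u - 1) = (R u - 1) * R s
      apply LinearMap.ext
      intro q
      have hc := LinearMap.congr_fun hcomm.eq q
      simp only [Module.End.mul_apply] at hc
      simp only [Module.End.mul_apply, LinearMap.sub_apply, Module.End.one_apply, map_sub, hc]
    have hN : IsNilpotent (R s * (R u - 1)) :=
      h1.isNilpotent_mul_left (isNilpotent_rTransRepDeg_sub_one hgsu.unipotent d)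
    have hNc : Commute (R s * (R u - 1)) (R s) := Commute.mul_left (Commute.refl _) h1.symm
    have hsum : R s * (R u - 1) + R s = R g := by
      apply LinearMap.ext
      intro q
      simp only [LinearMap.add_apply, Module.End.mul_apply, LinearMap.sub_apply,
        Module.End.one_apply, map_sub, hmul, sub_add_cancel]
    obtain ⟨N₀, hN₀, S₀, hS₀, hN₀nil, hS₀ss, he⟩ := (R g).exists_isNilpotent_isSemisimple
    have hc₀ : Commute N₀ S₀ := Algebra.commute_of_mem_adjoin_singleton_of_commute hS₀
      (Algebra.commute_of_mem_adjoin_self hN₀).symm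
    have huniq := Module.End.isNilpotent_isSemisimple_unique hN hSss hN₀nil hS₀ss hNc hc₀
      (hsum.trans he)
    rw [huniq.2]
    exact hS₀
  -- hence `𝓘(G)_{≤ d}` is `ρ(s)`-invariant; apply to `p`
  have hinv_s := mem_invtSubmodule_of_mem_adjoin hRs hinv
  have hpd : p ∈ MvPolynomial.restrictTotalDegree (GLCoord n) k d :=
    (MvPolynomial.mem_restrictTotalDegree _ _ _).2 le_rfl
  have hpI : (⟨p, hpd⟩ : MvPolynomial.restrictTotalDegree (GLCoord n) k d) ∈ Id := hp
  have h := (Module.End.mem_invtSubmodule (R s)).1 hinv_s hpI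
  rw [Submodule.mem_comap, hId, hR, coe_rTransRepDeg_apply] at h
  exact h

/-- **Jordan decomposition in an algebraic group** (Springer 2.4.8 (i), existence form; uniqueness
is `IsJordanDecomp.unique`): every element `g` of an algebraic subgroup `G ≤ GL n k` (over an
algebraically closed field) is `g = g_s g_u = g_u g_s` with `g_s ∈ G` semisimple and `g_u ∈ G`
unipotent. [cite: SpringerLAG1998, 2.4.8 (i)] -/
theorem exists_isJordanDecomp_mem {G : Subgroup (GL n k)} (hG : IsAlgebraicSubgroup G) {g : GL n k}
    (hg : g ∈ G) : ∃ s ∈ G, ∃ u ∈ G, IsJordanDecomp g s u := by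
  obtain ⟨s, u, h⟩ := exists_isJordanDecomp g
  obtain ⟨hs, hu⟩ := h.mem_of_mem hG hg
  exact ⟨s, hs, u, hu, h⟩

end JordanInGroup

/-! ### Semisimplicity and unipotence pass to quotients, powers of a space and subspaces -/

section Transfer

variable {V : Type*} [AddCommGroup V] [Module k V]

/-- The endomorphism induced on a quotient by an invariant subspace of a semisimple endomorphism
is semisimple (identify `V/p` with an invariant complement). [folklore] -/
theorem isSemisimple_mapQ [FiniteDimensional k V] {f : Module.End k V} (hf : f.IsSemisimple)
    {p : Submodule k V} (hp : p ∈ Module.End.invtSubmodule f) :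
    Module.End.IsSemisimple (p.mapQ p f (Module.End.mem_invtSubmodule f |>.1 hp)) := by
  obtain ⟨q, hq, hpq⟩ := Module.End.isSemisimple_iff.1 hf p hp
  have hfq := hf.restrict hq
  let e : q ≃ₗ[k] V ⧸ p := (p.quotientEquivOfIsCompl q hpq).symm
  refine (LinearEquiv.isSemisimple_iff _ _ e ?_).1 hfq
  apply LinearMap.ext
  intro x
  rfl

/-- If `f - 1` is nilpotent, so is the map induced on a quotient by an invariant subspace.
[folklore] -/
theorem isNilpotent_mapQ_sub_one {f : Module.End k V} (hf : IsNilpotent (f - 1)) {p : Submodule k V}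
    (hp : p ≤ p.comap f) : IsNilpotent (p.mapQ p f hp - 1) := by
  obtain ⟨N, hN⟩ := hf
  have hp' : p ≤ p.comap (f - 1) := fun v hv => by
    simpa using p.sub_mem (hp hv) hv
  refine ⟨N, ?_⟩
  have e : p.mapQ p f hp - 1 = p.mapQ p (f - 1) hp' := by
    apply LinearMap.ext
    intro x
    induction x using Submodule.Quotient.induction_on with
    | _ v => simp [Submodule.mapQ_apply]
  rw [e, ← Submodule.mapQ_pow]
  apply LinearMap.ext
  intro x
  induction x using Submodule.Quotient.induction_on with
  | _ v => simp [hN]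

variable {ι : Type*}

/-- Powers of the componentwise endomorphism `(f, …, f) = f.compLeft ι` of `ι → V` (Mathlib
`LinearMap.compLeft`) act componentwise by powers of `f`. [folklore] -/
lemma compLeft_pow_apply (f : Module.End k V) (j : ℕ) (x : ι → V) (i : ι) :
    ((f.compLeft ι : Module.End k (ι → V)) ^ j) x i = (f ^ j) (x i) := by
  induction j generalizing x with
  | zero => rfl
  | succ j ih => rw [pow_succ, Module.End.mul_apply, ih, pow_succ, Module.End.mul_apply]; rfl

/-- Polynomials in `f.compLeft ι` act componentwise by the same polynomials in `f`. [folklore] -/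
lemma aeval_compLeft_apply (f : Module.End k V) (r : k[X]) (x : ι → V) (i : ι) :
    aeval (f.compLeft ι : Module.End k (ι → V)) r x i = aeval f r (x i) := by
  refine r.induction_on' ?_ ?_
  · intro p q hp hq
    simp [hp, hq]
  · intro j a
    simp only [aeval_monomial, Module.End.mul_apply, Module.algebraMap_end_apply, Pi.smul_apply,
      compLeft_pow_apply]

/-- `(f, …, f) = f.compLeft ι` is semisimple if `f` is (same squarefree minimal polynomial).
[folklore] -/
theorem isSemisimple_compLeft [FiniteDimensional k V] [Finite ι] {f : Module.End k V}
    (hf : f.IsSemisimple) : Module.End.IsSemisimple (f.compLeft ι : Module.End k (ι → V)) := by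
  refine Module.End.isSemisimple_of_squarefree_aeval_eq_zero hf.minpoly_squarefree ?_
  apply LinearMap.ext
  intro x
  funext i
  rw [aeval_compLeft_apply, minpoly.aeval]
  rfl

/-- `(f, …, f) - 1` is nilpotent if `f - 1` is. [folklore] -/
theorem isNilpotent_compLeft_sub_one {f : Module.End k V} (hf : IsNilpotent (f - 1)) :
    IsNilpotent ((f.compLeft ι : Module.End k (ι → V)) - 1) := by
  obtain ⟨N, hN⟩ := hf
  refine ⟨N, ?_⟩
  have e : (f.compLeft ι : Module.End k (ι → V)) - 1 = (f - 1).compLeft ι := by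
    apply LinearMap.ext; intro x; funext i; simp
  rw [e]
  apply LinearMap.ext; intro x; funext i
  rw [compLeft_pow_apply, hN]
  rfl

/-- The restriction of `f` with `f - 1` nilpotent to an invariant subspace has the same property.
[folklore] -/
theorem isNilpotent_restrict_sub_one {f : Module.End k V} (hf : IsNilpotent (f - 1))
    {p : Submodule k V} (hp : ∀ x ∈ p, f x ∈ p) : IsNilpotent (f.restrict hp - 1) := by
  obtain ⟨N, hN⟩ := hf
  refine ⟨N, ?_⟩
  have hp' : ∀ x ∈ p, (f - 1) x ∈ p := fun x hx => by simpa using p.sub_mem (hp x hx) hx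
  have e : f.restrict hp - 1 = (f - 1).restrict hp' := by
    apply LinearMap.ext; intro x; apply Subtype.ext; simp [LinearMap.restrict_apply]
  have key : ∀ j : ℕ, ∀ x : p, ((((f - 1).restrict hp') ^ j) x : V) = ((f - 1) ^ j) (x : V) := by
    intro j
    induction j with
    | zero => intro x; rfl
    | succ j ih =>
      intro x
      rw [pow_succ, Module.End.mul_apply, ih, pow_succ, Module.End.mul_apply]
      rfl
  rw [e]
  apply LinearMap.ext; intro x; apply Subtype.ext
  rw [key, hN]
  rfl

end Transfer

/-! ### Springer 2.4.8 (ii): algebraic homomorphisms preserve the Jordan decomposition -/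

section Homomorphism

variable {m : Type*} [Fintype m] [DecidableEq m]

/-- The matrix coefficient polynomials of an algebraic homomorphism `φ : G → GL m k` with
coordinate polynomials `P`: `F v i = ∑ⱼ vⱼ · P_{ij}`, so that `F v i (g) = (φ(g) v)ᵢ`. [folklore] -/
noncomputable def matrixCoeffPoly (P : GLCoord m → MvPolynomial (GLCoord n) k) (v : m → k) (i : m) :
    MvPolynomial (GLCoord n) k :=
  ∑ j, MvPolynomial.C (v j) * P (Sum.inl (i, j))

omit [Fintype n] [DecidableEq n] [DecidableEq m] in
/-- `matrixCoeffPoly P` is additive in the vector. [folklore] -/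
lemma matrixCoeffPoly_add (P : GLCoord m → MvPolynomial (GLCoord n) k) (v w : m → k) (i : m) :
    matrixCoeffPoly P (v + w) i = matrixCoeffPoly P v i + matrixCoeffPoly P w i := by
  simp [matrixCoeffPoly, add_mul, Finset.sum_add_distrib]

omit [Fintype n] [DecidableEq n] [DecidableEq m] in
/-- `matrixCoeffPoly P` is homogeneous in the vector. [folklore] -/
lemma matrixCoeffPoly_smul (P : GLCoord m → MvPolynomial (GLCoord n) k) (a : k) (v : m → k) (i : m) :
    matrixCoeffPoly P (a • v) i = a • matrixCoeffPoly P v i := by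
  simp [matrixCoeffPoly, Finset.smul_sum, MvPolynomial.smul_eq_C_mul, mul_assoc]

omit [Fintype n] [DecidableEq n] [DecidableEq m] in
/-- The matrix coefficient polynomials have total degree bounded by that of the coordinate
polynomials. [folklore] -/
lemma totalDegree_matrixCoeffPoly_le (P : GLCoord m → MvPolynomial (GLCoord n) k) {d : ℕ}
    (hPd : ∀ c, (P c).totalDegree ≤ d) (v : m → k) (i : m) :
    (matrixCoeffPoly P v i).totalDegree ≤ d := by
  refine (MvPolynomial.totalDegree_finsetSum _ _).trans (Finset.sup_le fun j _ => ?_)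
  refine (MvPolynomial.totalDegree_mul _ _).trans ?_
  rw [MvPolynomial.totalDegree_C, zero_add]
  exact hPd _

/-- `F v i (g) = (φ(g) v)ᵢ`. [folklore] -/
lemma eval_matrixCoeffPoly {G : Subgroup (GL n k)} {φ : ↥G →* GL m k}
    {P : GLCoord m → MvPolynomial (GLCoord n) k}
    (hP : ∀ (g : ↥G) (c : GLCoord m), glCoordFun (φ g) c =
      MvPolynomial.eval (glCoordFun (g : GL n k)) (P c)) (g : ↥G) (v : m → k) (i : m) :
    MvPolynomial.eval (glCoordFun (g : GL n k)) (matrixCoeffPoly P v i) =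
      (((φ g : GL m k) : Matrix m m k) *ᵥ v) i := by
  simp only [matrixCoeffPoly, map_sum, map_mul, MvPolynomial.eval_C, ← hP, glCoordFun_inl,
    Matrix.mulVec, dotProduct]
  exact Finset.sum_congr rfl fun j _ => mul_comm _ _

/-- **The equivariant embedding of a rational representation into (a power of a quotient of) the
regular representation** (Springer 2.3.6 (ii), proof of 2.4.8 (iii): `v ↦ (g ↦ ℓᵢ(φ(g) v))`). For
an algebraic homomorphism `φ : G → GL m k` on a subgroup `G ≤ GL n k` (Springer assumes `G`
closed; the closedness is not needed here and not assumed), there are `d`, the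
`G`-stable subspace `𝓘(G)_{≤ d} ⊆ k[x_{ij}, det⁻¹]_{≤ d}`, and an injective linear map
`T : kᵐ → (k[x_{ij}, det⁻¹]_{≤ d} / 𝓘(G)_{≤ d})ᵐ` intertwining `φ(g)` with the map induced by
right translation `ρ(g)`. [cite: SpringerLAG1998, 2.4.8 (proof of (iii))] -/
theorem exists_intertwiner_rTransRepDeg {G : Subgroup (GL n k)} {φ : ↥G →* GL m k}
    (hφ : MonoidHom.IsAlgebraicGL φ) :
    ∃ (d : ℕ) (Id : Submodule k (MvPolynomial.restrictTotalDegree (GLCoord n) k d))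
      (hinv : ∀ g ∈ G, Id ≤ Id.comap (rTransRepDeg (k := k) d g))
      (T : (m → k) →ₗ[k] (m → MvPolynomial.restrictTotalDegree (GLCoord n) k d ⧸ Id)),
      Function.Injective T ∧
      ∀ (g : GL n k) (hg : g ∈ G) (v : m → k),
        T ((((φ ⟨g, hg⟩ : GL m k) : Matrix m m k)) *ᵥ v) =
          fun i => Id.mapQ Id (rTransRepDeg (k := k) d g) (hinv g hg) (T v i) := by
  classical
  obtain ⟨P, hP⟩ := hφ
  set d : ℕ := Finset.univ.sup fun c : GLCoord m => (P c).totalDegree with hd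
  have hPd : ∀ c, (P c).totalDegree ≤ d := fun c =>
    Finset.le_sup (f := fun c : GLCoord m => (P c).totalDegree) (Finset.mem_univ c)
  set I := MvPolynomial.vanishingIdeal k (glCoordFun '' (G : Set (GL n k))) with hI
  let Id : Submodule k (MvPolynomial.restrictTotalDegree (GLCoord n) k d) :=
    (I.restrictScalars k).comap (MvPolynomial.restrictTotalDegree (GLCoord n) k d).subtype
  have hId : ∀ q : MvPolynomial.restrictTotalDegree (GLCoord n) k d,
      q ∈ Id ↔ (q : MvPolynomial (GLCoord n) k) ∈ I := fun q => Iff.rfl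
  set R := rTransRepDeg (k := k) (n := n) d with hR
  have hinv : ∀ g ∈ G, Id ≤ Id.comap (R g) := by
    intro g hg q hq
    rw [Submodule.mem_comap, hId, hR, coe_rTransRepDeg_apply]
    exact rTransGL_mem_vanishingIdeal hg ((hId q).1 hq)
  have hFdeg : ∀ (v : m → k) (i : m),
      matrixCoeffPoly P v i ∈ MvPolynomial.restrictTotalDegree (GLCoord n) k d := fun v i =>
    (MvPolynomial.mem_restrictTotalDegree _ _ _).2 (totalDegree_matrixCoeffPoly_le P hPd v i)
  let T : (m → k) →ₗ[k] (m → MvPolynomial.restrictTotalDegree (GLCoord n) k d ⧸ Id) :=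
    { toFun := fun v i => Id.mkQ ⟨matrixCoeffPoly P v i, hFdeg v i⟩
      map_add' := fun v w => by
        funext i
        rw [Pi.add_apply, ← map_add]
        congr 1
        exact Subtype.ext (matrixCoeffPoly_add P v w i)
      map_smul' := fun a v => by
        funext i
        rw [Pi.smul_apply, RingHom.id_apply, ← map_smul]
        congr 1
        exact Subtype.ext (matrixCoeffPoly_smul P a v i) }
  have hTapp : ∀ v i, T v i = Id.mkQ ⟨matrixCoeffPoly P v i, hFdeg v i⟩ := fun v i => rfl
  refine ⟨d, Id, hinv, T, ?_, ?_⟩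
  · -- injective: evaluate at `e`
    intro v w hvw
    rw [← sub_eq_zero]
    have h0 : T (v - w) = 0 := by rw [map_sub, hvw, sub_self]
    funext i
    have h1 := congrFun h0 i
    rw [hTapp, Pi.zero_apply, Submodule.mkQ_apply, Submodule.Quotient.mk_eq_zero, hId] at h1
    have h2 := (mem_vanishingIdeal_glCoordFun_iff.1 h1) 1 G.one_mem
    rw [eval_matrixCoeffPoly hP ⟨1, G.one_mem⟩, show (⟨1, G.one_mem⟩ : ↥G) = 1 from rfl, map_one,
      Units.val_one, Matrix.one_mulVec] at h2
    simpa using h2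
  · -- intertwining: the two polynomials agree on `G`
    intro g hg v
    funext i
    rw [hTapp, hTapp, Submodule.mkQ_apply, Submodule.mkQ_apply, Submodule.mapQ_apply, ← sub_eq_zero,
      ← Submodule.Quotient.mk_sub, Submodule.Quotient.mk_eq_zero, hId]
    rw [mem_vanishingIdeal_glCoordFun_iff]
    intro x hx
    rw [Submodule.coe_sub, map_sub, coe_rTransRepDeg_apply, eval_rTransGL,
      eval_matrixCoeffPoly hP ⟨x, hx⟩,
      show glCoordFun (x * g) = glCoordFun (((⟨x, hx⟩ * ⟨g, hg⟩ : ↥G) : GL n k)) from rfl,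
      eval_matrixCoeffPoly hP (⟨x, hx⟩ * ⟨g, hg⟩), map_mul, Units.val_mul, ← Matrix.mulVec_mulVec,
      sub_self]

/-- **Springer 2.4.8 (ii), semisimple part: algebraic homomorphisms map semisimple elements to
semisimple elements.** For a subgroup `G ≤ GL n k` over an algebraically closed field (Springer
assumes `G` closed; not needed here) and an algebraic homomorphism `φ : G → GL m k`, `φ(s)` is
semisimple whenever `s ∈ G` is. Proof: by
`exists_intertwiner_rTransRepDeg`, `kᵐ` with `φ(s)` embeds equivariantly into a power of a quotient
of `k[x_{ij}, det⁻¹]_{≤ d}` with `ρ(s)`, which is semisimple (`isSemisimple_rTransRepDeg`), and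
semisimplicity passes to quotients, powers and invariant subspaces.
[cite: SpringerLAG1998, 2.4.8 (ii)] -/
theorem IsSemisimpleElt.map_of_isAlgebraicGL [IsAlgClosed k] {G : Subgroup (GL n k)}
    {φ : ↥G →* GL m k} (hφ : MonoidHom.IsAlgebraicGL φ) {s : GL n k} (hsG : s ∈ G)
    (hs : IsSemisimpleElt s) : IsSemisimpleElt (φ ⟨s, hsG⟩) := by
  obtain ⟨d, Id, hinv, T, hTinj, hT⟩ := exists_intertwiner_rTransRepDeg hφ
  set B := Id.mapQ Id (rTransRepDeg (k := k) d s) (hinv s hsG) with hB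
  have hB' : Module.End.IsSemisimple B :=
    isSemisimple_mapQ (isSemisimple_rTransRepDeg hs d)
      ((Module.End.mem_invtSubmodule _).2 (hinv s hsG))
  have hpi : Module.End.IsSemisimple (B.compLeft m : Module.End k (m → _)) := isSemisimple_compLeft hB'
  -- `range T` is invariant
  have hW : ∀ x ∈ LinearMap.range T, (B.compLeft m : Module.End k (m → _)) x ∈ LinearMap.range T := by
    rintro _ ⟨v, rfl⟩
    refine ⟨(((φ ⟨s, hsG⟩ : GL m k) : Matrix m m k)) *ᵥ v, ?_⟩
    rw [hT s hsG v]
    rfl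
  have hWmem : LinearMap.range T ∈ Module.End.invtSubmodule ((B.compLeft m : Module.End k (m → _))) :=
    (Module.End.mem_invtSubmodule_iff_forall_mem_of_mem _).2 hW
  have hres := hpi.restrict hWmem
  let e : (m → k) ≃ₗ[k] LinearMap.range T := LinearEquiv.ofInjective T hTinj
  refine (LinearEquiv.isSemisimple_iff (Matrix.toLin' (((φ ⟨s, hsG⟩ : GL m k) : Matrix m m k)))
    _ e ?_).2 hres
  apply LinearMap.ext
  intro v
  apply Subtype.ext
  change T (Matrix.toLin' (((φ ⟨s, hsG⟩ : GL m k) : Matrix m m k)) v) = (B.compLeft m : Module.End k (m → _)) (T v)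
  rw [Matrix.toLin'_apply, hT s hsG v]
  rfl

/-- Conjugates of unipotent-type endomorphisms: if `e ∘ A = B ∘ e` for a linear equivalence `e` and
`B - 1` is nilpotent then so is `A - 1`. [folklore] -/
lemma isNilpotent_sub_one_of_conj {V W : Type*} [AddCommGroup V] [Module k V] [AddCommGroup W]
    [Module k W] {A : Module.End k V} {B : Module.End k W} (e : V ≃ₗ[k] W)
    (he : (e : V →ₗ[k] W) ∘ₗ A = B ∘ₗ (e : V →ₗ[k] W)) (hB : IsNilpotent (B - 1)) :
    IsNilpotent (A - 1) := by
  obtain ⟨N, hN⟩ := hB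
  refine ⟨N, ?_⟩
  have key : ∀ (j : ℕ) (v : V), e (((A - 1) ^ j) v) = ((B - 1) ^ j) (e v) := by
    intro j
    induction j with
    | zero => intro v; rfl
    | succ j ih =>
      intro v
      rw [pow_succ, Module.End.mul_apply, ih, pow_succ, Module.End.mul_apply]
      congr 1
      have h := LinearMap.congr_fun he v
      simp only [LinearMap.coe_comp, Function.comp_apply, LinearEquiv.coe_coe] at h
      simp [h]
  apply LinearMap.ext
  intro v
  apply e.injective
  rw [key, hN, LinearMap.zero_apply, LinearMap.zero_apply, map_zero]

/-- **Springer 2.4.8 (ii), unipotent part: algebraic homomorphisms map unipotent elements to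
unipotent elements** (for any subgroup `G ≤ GL n k`, closedness not needed; same equivariant
embedding; `ρ(u) - 1` is nilpotent on each piece, `isNilpotent_rTransRepDeg_sub_one`, and this
passes to quotients, powers, invariant subspaces and conjugates).
[cite: SpringerLAG1998, 2.4.8 (ii)] -/
theorem IsUnipotentElt.map_of_isAlgebraicGL {G : Subgroup (GL n k)} {φ : ↥G →* GL m k}
    (hφ : MonoidHom.IsAlgebraicGL φ) {u : GL n k} (huG : u ∈ G) (hu : IsUnipotentElt u) :
    IsUnipotentElt (φ ⟨u, huG⟩) := by
  obtain ⟨d, Id, hinv, T, hTinj, hT⟩ := exists_intertwiner_rTransRepDeg hφ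
  set B := Id.mapQ Id (rTransRepDeg (k := k) d u) (hinv u huG) with hB
  have hB' : IsNilpotent (B - 1) := isNilpotent_mapQ_sub_one (isNilpotent_rTransRepDeg_sub_one hu d) _
  have hpi : IsNilpotent ((B.compLeft m : Module.End k (m → _)) - 1) := isNilpotent_compLeft_sub_one hB'
  have hW : ∀ x ∈ LinearMap.range T, (B.compLeft m : Module.End k (m → _)) x ∈ LinearMap.range T := by
    rintro _ ⟨v, rfl⟩
    refine ⟨(((φ ⟨u, huG⟩ : GL m k) : Matrix m m k)) *ᵥ v, ?_⟩
    rw [hT u huG v]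
    rfl
  have hres : IsNilpotent (((B.compLeft m : Module.End k (m → _))).restrict hW - 1) := isNilpotent_restrict_sub_one hpi hW
  let e : (m → k) ≃ₗ[k] LinearMap.range T := LinearEquiv.ofInjective T hTinj
  have hA : IsNilpotent (Matrix.toLin' (((φ ⟨u, huG⟩ : GL m k) : Matrix m m k)) - 1) := by
    refine isNilpotent_sub_one_of_conj e ?_ hres
    apply LinearMap.ext
    intro v
    apply Subtype.ext
    change T (Matrix.toLin' (((φ ⟨u, huG⟩ : GL m k) : Matrix m m k)) v) = (B.compLeft m : Module.End k (m → _)) (T v)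
    rw [Matrix.toLin'_apply, hT u huG v]
    rfl
  -- back to matrices
  have h' : IsNilpotent (Matrix.toLinAlgEquiv' ((((φ ⟨u, huG⟩ : GL m k) : Matrix m m k)) - 1)) := by
    rw [map_sub, map_one]
    exact hA
  exact (IsNilpotent.map_iff (Matrix.toLinAlgEquiv' (R := k) (n := m)).injective).1 h'

/-- **Springer 2.4.8 (ii): algebraic homomorphisms preserve the Jordan decomposition.** If
`g = s u` is the Jordan decomposition of `g ∈ G` then `φ(g) = φ(s) φ(u)` is that of `φ(g)`.
[cite: SpringerLAG1998, 2.4.8 (ii)] -/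
theorem IsJordanDecomp.map_of_isAlgebraicGL [IsAlgClosed k] {G : Subgroup (GL n k)}
    (hG : IsAlgebraicSubgroup G) {φ : ↥G →* GL m k} (hφ : MonoidHom.IsAlgebraicGL φ) {g s u : GL n k}
    (hg : g ∈ G) (h : IsJordanDecomp g s u) :
    IsJordanDecomp (φ ⟨g, hg⟩) (φ ⟨s, (h.mem_of_mem hG hg).1⟩) (φ ⟨u, (h.mem_of_mem hG hg).2⟩) := by
  obtain ⟨hs, hu⟩ := h.mem_of_mem hG hg
  refine ⟨h.semisimple.map_of_isAlgebraicGL hφ hs, h.unipotent.map_of_isAlgebraicGL hφ hu, ?_, ?_⟩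
  · rw [← map_mul]
    congr 1
    exact Subtype.ext h.mul_eq
  · change φ ⟨s, hs⟩ * φ ⟨u, hu⟩ = φ ⟨u, hu⟩ * φ ⟨s, hs⟩
    rw [← map_mul, ← map_mul]
    congr 1
    exact Subtype.ext h.commute.eq

end Homomorphism

end Literature.NumberTheory.Automorphic
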